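import Summits.CriticalPhenomena.PercolationContinuityZ3.Theses.PercBudgetLadder

/-!
# Dry run of the RESTATEMENT of `PercBudgetLadder.PinholeClosing` and of its deciding theorem

Crux-plan seat planner-cruxplan-stmt-CriticalPhenomena-5249-budget-halving-0.  This file imports ONLY the
route file (exactly the environment in which the gate elaborates `glue.lean`), declares the proposed restated
body as `PinholeClosingRestated` (fully qualified names, route style) and proves the deciding theorem
`closes_restated : BudgetTightness → PinholeClosingRestated → BlockingVanishesOfTheta → PercolationContinuityZ3`
self-contained (no Literature lemma, no helper def: one theorem, pure logic + a set identity), i.e. the text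
the tenure planner can paste into `glue.lean` as `theorem closes` after
`ledger route edit route-CriticalPhenomena-PercBudgetLadder --restate PinholeClosing --statement '<body below>' --closes-file glue.lean`.
-/

namespace Summit.CriticalPhenomena.PercolationContinuityZ3.Theses.PercBudgetLadder

/-- PROPOSED RESTATED BODY of `PinholeClosing` (card budget-halving + TRIAGE-r1-1/2/3): hypothesis unchanged
(budget `k+1` at inner radius `n`, aspect `l`, probability `≥ c`, every `n ≥ 1`); conclusion: budget `k` at
SOME inner radius `m` with `n ≤ 2^j m` and outer radius `l' m`, probability `≥ c'`, where `j, l', c'` depend on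
`(k, l, c)` only.  Weaker than the typed body (typed ⇒ this with `j = 1`, `l' = 4 l`), still decides the
sub-problem (`closes_restated`). -/
def PinholeClosingRestated : Prop :=
  ∀ (k l : ℕ) (c : ℝ), 2 ≤ l → 0 < c → ∃ (j l' : ℕ) (c' : ℝ), 2 ≤ l' ∧ 0 < c' ∧ ∀ n : ℕ, 1 ≤ n → c ≤ (Literature.Probability.Percolation.bondPercolation (Literature.Probability.LatticeModels.zdGraph 3) (Literature.Probability.Percolation.criticalProbI 3)).real {ω | ∃ S : Finset (Sym2 (Literature.Probability.LatticeModels.Site 3)), S.card ≤ k + 1 ∧ ¬ ∃ x ∈ Literature.Probability.LatticeModels.box 3 n, ∃ y ∈ Literature.Probability.LatticeModels.innerBoundary (Literature.Probability.LatticeModels.zdGraph 3) (Literature.Probability.LatticeModels.box 3 (l * n)), (ω \ ↑S) ∈ Literature.Probability.Percolation.openConnIn ↑(Literature.Probability.LatticeModels.box 3 (l * n)) x y} → ∃ m : ℕ, n ≤ 2 ^ j * m ∧ c' ≤ (Literature.Probability.Percolation.bondPercolation (Literature.Probability.LatticeModels.zdGraph 3) (Literature.Probability.Percolation.criticalProbI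 3)).real {ω | ∃ S : Finset (Sym2 (Literature.Probability.LatticeModels.Site 3)), S.card ≤ k ∧ ¬ ∃ x ∈ Literature.Probability.LatticeModels.box 3 m, ∃ y ∈ Literature.Probability.LatticeModels.innerBoundary (Literature.Probability.LatticeModels.zdGraph 3) (Literature.Probability.LatticeModels.box 3 (l' * m)), (ω \ ↑S) ∈ Literature.Probability.Percolation.openConnIn ↑(Literature.Probability.LatticeModels.box 3 (l' * m)) x y}

/-- The deciding theorem under the restatement (paste as `theorem closes` into glue.lean, replacing
`PinholeClosingRestated` by `PinholeClosing`). -/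
theorem closes_restated : BudgetTightness → PinholeClosingRestated → BlockingVanishesOfTheta →
    _root_.PercolationContinuityZ3 := by
  intro hBT hPC hBV
  -- dictionary, local to the proof: P k n m = P_{p_c}(budget-k blocked event of box n → ∂ box m)
  let P : ℕ → ℕ → ℕ → ℝ := fun k n m =>
    (Literature.Probability.Percolation.bondPercolation (Literature.Probability.LatticeModels.zdGraph 3)
      (Literature.Probability.Percolation.criticalProbI 3)).real
      {ω | ∃ S : Finset (Sym2 (Literature.Probability.LatticeModels.Site 3)), S.card ≤ k ∧
        ¬ ∃ x ∈ Literature.Probability.LatticeModels.box 3 n,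
          ∃ y ∈ Literature.Probability.LatticeModels.innerBoundary
            (Literature.Probability.LatticeModels.zdGraph 3) (Literature.Probability.LatticeModels.box 3 m),
            (ω \ ↑S) ∈ Literature.Probability.Percolation.openConnIn
              ↑(Literature.Probability.LatticeModels.box 3 m) x y}
  -- K-step descent: i.o. bound at budget K, aspect l ⟹ i.o. bound at budget 0, some aspect l'
  -- (the inner radii of the subsequence shrink by 2^j per step and still tend to infinity)
  have descent : ∀ K : ℕ, ∀ (l : ℕ) (c : ℝ), 2 ≤ l → 0 < c →
      (∀ N : ℕ, ∃ n : ℕ, N ≤ n ∧ c ≤ P K n (l * n)) →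
      ∃ (l' : ℕ) (c' : ℝ), 2 ≤ l' ∧ 0 < c' ∧ ∀ N : ℕ, ∃ n : ℕ, N ≤ n ∧ c' ≤ P 0 n (l' * n) := by
    intro K
    induction K with
    | zero => exact fun l c hl hc h => ⟨l, c, hl, hc, h⟩
    | succ K ih =>
      intro l c hl hc h
      obtain ⟨j, l', c', hl', hc', hstep⟩ := hPC K l c hl hc
      refine ih l' c' hl' hc' fun N => ?_
      obtain ⟨n, hn, hb⟩ := h (2 ^ j * N + 1)
      obtain ⟨m, hm, hbm⟩ := hstep n (by omega) hb
      refine ⟨m, ?_, hbm⟩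
      have h3 : 2 ^ j * N ≤ 2 ^ j * m := (Nat.le_of_succ_le hn).trans hm
      exact Nat.le_of_mul_le_mul_left h3 (Nat.two_pow_pos j)
  obtain ⟨K, l, c, hl, hc, hio⟩ := hBT
  obtain ⟨l', c', hl', hc', hio'⟩ := descent K l c hl hc hio
  -- budget 0 is the blocked event
  have hblocked : ∀ N : ℕ, ∃ n : ℕ, N ≤ n ∧ c' ≤ (Literature.Probability.Percolation.bondPercolation
        (Literature.Probability.LatticeModels.zdGraph 3)
        (Literature.Probability.Percolation.criticalProbI 3)).real
      {ω | ¬ ∃ x ∈ Literature.Probability.LatticeModels.box 3 n,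
            ∃ y ∈ Literature.Probability.LatticeModels.innerBoundary
              (Literature.Probability.LatticeModels.zdGraph 3)
              (Literature.Probability.LatticeModels.box 3 (l' * n)),
            ω ∈ Literature.Probability.Percolation.openConnIn
              ↑(Literature.Probability.LatticeModels.box 3 (l' * n)) x y} := by
    intro N
    obtain ⟨n, hn, hbound⟩ := hio' N
    refine ⟨n, hn, ?_⟩
    have hset :
        {ω : Set (Sym2 (Literature.Probability.LatticeModels.Site 3)) |
          ∃ S : Finset (Sym2 (Literature.Probability.LatticeModels.Site 3)), S.card ≤ 0 ∧
            ¬ ∃ x ∈ Literature.Probability.LatticeModels.box 3 n,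
              ∃ y ∈ Literature.Probability.LatticeModels.innerBoundary
                (Literature.Probability.LatticeModels.zdGraph 3)
                (Literature.Probability.LatticeModels.box 3 (l' * n)),
              (ω \ ↑S) ∈ Literature.Probability.Percolation.openConnIn
                ↑(Literature.Probability.LatticeModels.box 3 (l' * n)) x y} =
        {ω | ¬ ∃ x ∈ Literature.Probability.LatticeModels.box 3 n,
              ∃ y ∈ Literature.Probability.LatticeModels.innerBoundary
                (Literature.Probability.LatticeModels.zdGraph 3)
                (Literature.Probability.LatticeModels.box 3 (l' * n)),
              ω ∈ Literature.Probability.Percolation.openConnIn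
                ↑(Literature.Probability.LatticeModels.box 3 (l' * n)) x y} := by
      ext ω
      constructor
      · rintro ⟨S, hS, hnot⟩
        have hS0 : S = ∅ := Finset.card_eq_zero.mp (Nat.le_zero.mp hS)
        subst hS0
        simpa using hnot
      · intro hnot
        exact ⟨∅, by simp, by simpa using hnot⟩
    have hb' : c' ≤ P 0 n (l' * n) := hbound
    simp only [P] at hb'
    rw [hset] at hb'
    exact hb'
  -- it suffices: θ(p_c) ≠ 0 would make the blocking probability at aspect l' tend to 0
  by_contra hne
  have h0 : 0 ≤ Literature.Probability.Percolation.theta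
      (Literature.Probability.LatticeModels.zdGraph 3) 0
      (Literature.Probability.Percolation.criticalProbI 3) := by
    unfold Literature.Probability.Percolation.theta
    exact MeasureTheory.measureReal_nonneg
  have hpos : 0 < Literature.Probability.Percolation.theta
      (Literature.Probability.LatticeModels.zdGraph 3) 0
      (Literature.Probability.Percolation.criticalProbI 3) :=
    lt_of_le_of_ne h0 (fun h => hne h.symm)
  have hT := hBV (Literature.Probability.Percolation.criticalProbI 3) hpos l' hl'
  have hev := hT.eventually (gt_mem_nhds hc')
  obtain ⟨N, hN⟩ := Filter.eventually_atTop.mp hev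
  obtain ⟨n, hn, hbound⟩ := hblocked N
  exact absurd (hN n hn) (not_lt.mpr hbound)

/-- Sanity: the TYPED body implies the restated one (`j = 1`, `l' = 4l`) is proved in
`Cruxes/PinholeClosing/Lines/budget-halving.lean` (`pinholeClosingFlex_of_pinholeClosing`, using the landed
a.s. monotonicities); here only the logical shape is exercised. -/
example : PinholeClosingRestated ↔ PinholeClosingRestated := Iff.rfl

end Summit.CriticalPhenomena.PercolationContinuityZ3.Theses.PercBudgetLadder
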